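import Summits.QuantumFields.YangMills.Theses.QuantileBitPurity
import Summits.QuantumFields.YangMills.Theorems.QuantileBitPurityBitPersistence
import HarnessLib

/-!
# The RESTRICTED door `QuantileBitPurity.QuantileBitDoorDeepR` (item stmt-QuantumFields-24094, cap `2/5`): a quantile of the Polyakov holonomy off the
# core, a vanishing equator band, and Lévy anti-concentration at centres BETWEEN the core and the equator force a purity deficit
# `Z_phys(2L) ≤ (1 − β⁻¹) Z_phys(L)²` on a window `L ≤ β^a`

Route `QuantileBitPurity` rev 4 of seat ym-idea-4 (target leaf `ThermalTraceWindow.SubFemtoTraceRatio` = K2; ruling (ii) of the critic of record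
2026-08-29T04:27Z: the Lévy window is retyped with centres `β^{−γc} ≤ c ≤ 2 − β^{−γc}` — away from the equator `polDist = 2`, `tr P = 0`, where the
`x`-twisted flat sectors sit — and the door receives the rate-free input `EquatorBandVanishing`).  We prove
★ `quantileBitDoorR_of_cap κ` — X1(κ) → EQ(κ) → X2R(κ) → `∃ a > 0, ∃ k β₀ L₀, ∀ β ≥ β₀, ∀ L₀ ≤ L ≤ β^a, Z_phys(2L) ≤ (1 − β^{−k}) Z_phys(L)²` (with
`k = 1`, `a = min(a₁, a₀/2, a₂)`) for EVERY real `κ`, and the route's support item ★ `quantileBitDoorDeepR_proof : QuantileBitDoorDeepR` (⟨24094⟩,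
`κ = 2/5`) BY NAME as its instance.  The proof is that of `quantileBitDoor_of_cap` (module `QuantileBitPurityQuantileBitDoorDeep`, items ⟨23925⟩/⟨23950⟩)
with ONE change: the `β^{−γ}`-grid of centres starting at the core scale `x₀ = β^{−γc}` is CUT at `K = ⌊(2 − 2x₀)/β^{−γ}⌋`, so that every grid centre lies in
`[β^{−γc}, 2 − β^{−γc}]`, and the level `θ Z`, `θ = (1 + q⁺)/2`, is still reached at the last grid point `c_K > 2 − x₀ − β^{−γ}` because
`{polDist > c_K} ⊆ {|polDist − (2 − x₀)| ≤ β^{−γ}} ∪ {2 − β^{−γc} ≤ polDist}` costs at most `(β^{−a₀} + (1 − q⁺)/4) Z < (1 − θ) Z` — ONE Lévy window at the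
admissible centre `2 − β^{−γc}` plus the equator band with `ε = (1 − q⁺)/4`.

Mechanism (unchanged: a two-time trace computed two ways and split by levels; no entropy factor, no `λ₁`, no estimate at the toron core or at the equator):
* (module `QuantileBitPurityBitPersistence`, `bit_one_step_ge`) — PERSISTENCE of the quantile bit `O_c = 1 − 2·𝟙{polDist ≤ c}` on the ring of `L`
  transfer kernels: a Lévy bound `weight{|polDist − c| ≤ β^{−γ}} ≤ β^{−a} Z` gives `I_1 = Tr(O T O T^{L−1}) ≥ (1 − 3β^{−a}) Z`;
* the QUANTILE: on the cut grid the slice weight `F(c) = weight{polDist ≤ c}` first reaches `θ Z` at some admissible `c` with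
  `θ Z ≤ F(c) < (θ + β^{−a₀}) Z` (X1 at the core scale, X2R at the centre `c`); then tangent-line JENSEN on pairs of levels (`I_m Z^{m−1} ≥ I_1^m`,
  `m = ⌊L/2⌋`, so `I_m ≥ (1 − 1.5 β^{−a₀/2}) Z` on `L ≤ β^{a₀/2}`) against the LEVEL SPLIT of `I_m` (`ring_levels`:
  `I_m ≤ max(F(c), Z − F(c)) + (Z − λ_0^L)(1 + 2β^{(L−m)/L}) + 2λ_0^L β^{−m/L}`, scale `σ = β^{1/L}`) forces `Z − λ_0^L ≥ β^{−1} Z` for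
  `β ≥ (8/(1−θ))^{1/e}`, `e = min(a₀/2, 1/3)`, whence `Z_phys(2L) ≤ λ_0^L Z_phys(L) ≤ (1 − β^{−1}) Z_phys(L)²`.

HONEST FRAMING: a reduction (door) between fixed-lattice statements of a DRAFT-by-design line; the cruxes `HolonomyQuantileSubQuartic`,
`EquatorBandVanishing`, `HolonomyLevyWindowDeepR` and the residual tail `PurityDeficitPolyTail` are NOT proved here; no summit / rung statement is
proved; the YM mass gap is NOT proved.  No `sorry`, no new axiom, no new definition.  References: [cite: MadrasSokal1988, §2];
[cite: ReedSimonIV1978, Thm. XIII.1]; [cite: MontvayMunster1994, (3.145)]; [cite: Luscher1983, §2]; [cite: SeilerLNP1982, §3].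
-/

set_option autoImplicit false

noncomputable section

open MeasureTheory Filter Topology Real Function
open scoped Matrix ComplexConjugate BigOperators
open Literature.MathematicalPhysics.QuantumLattice
open Literature.MathematicalPhysics.QuantumFieldTheory hiding SU2
open Summit.QuantumFields.YangMills.Theorems

namespace Summit.QuantumFields.YangMills.Theorems.QuantileBitPurity

open Summit.QuantumFields.YangMills.Theorems.FemtoTransferGap
open Summit.QuantumFields.YangMills.Theorems.FemtoTransferGap.FlatSheet
open Summit.QuantumFields.YangMills.Theorems.FemtoTransferGap.TT

/-! ## The restricted door at a general cap -/

set_option maxHeartbeats 1600000 in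
/-- ★ **The restricted quantile-bit door at a general core cap `κ`.**  If (X1_κ) some quantile of the `x`-Polyakov holonomy distance-to-centre sits above
a core scale `β^{−γc}` with `0 < γc ≤ κ` (slice weight of `{polDist ≤ β^{−γc}}` at most `q·Z_phys(L)`, `q < 1`, on a window `L ≤ β^{a₁}`), (EQ_κ) for every
`0 < γc ≤ κ` and every `ε > 0` the equator band `{2 − β^{−γc} ≤ polDist}` has slice weight `≤ ε·Z_phys(L)` on some window `L ≤ β^{a₂}`, and (X2R_κ) for
every `γc ≤ κ` the slice law has Lévy concentration `≤ β^{−a}` at scale `β^{−γ}` at every centre `β^{−γc} ≤ c ≤ 2 − β^{−γc}` (window `L ≤ β^a`, all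
`a ≤ a₀`, some `γ < 1/2 − 3a`), THEN `Z_phys(2L) ≤ (1 − β^{−1}) Z_phys(L)²` for `β ≥ β₀`, `L₀ ≤ L ≤ β^{min(a₁, a₀/2, a₂)}`.  Same mechanism as
`quantileBitDoor_of_cap`: a `±1` QUANTILE BIT `O_c` with non-extreme thermal weights (`θ Z ≤ weight{polDist ≤ c} < (θ + β^{−a₀}) Z`, `θ = (1 + q⁺)/2 < 1`),
the centre `c` now found on the `β^{−γ}`-grid from `x₀ = β^{−γc}` CUT at `K = ⌊(2 − 2x₀)/β^{−γ}⌋` (all centres in `[x₀, 2 − x₀]`; the level is reached at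
`c_K` since `{polDist > c_K} ⊆ {|polDist − (2 − x₀)| ≤ β^{−γ}} ∪ {2 − x₀ ≤ polDist}` weighs `≤ (β^{−a₀} + (1−q⁺)/4) Z < (1 − θ) Z` by one Lévy window at the
admissible centre `2 − x₀` and the equator band with `ε = (1 − q⁺)/4`); persistence (`bit_one_step_ge`) and tangent-line Jensen give
`Tr(O T^m O T^{L−m}) ≥ (1 − 1.5β^{−a₀/2}) Z`, while the level split (`ring_levels`, scale `σ = β^{1/L}`) bounds the same trace by
`(θ + β^{−a₀}) Z + 5β^{−1/3} Z` when `Z − λ_0^L < β^{−1} Z` — impossible for `β ≥ (8/(1−θ))^{1/e}`, `e = min(a₀/2, 1/3)`; hence `λ_0^L ≤ (1 − β^{−1}) Z` and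
`Z_phys(2L) ≤ λ_0^L Z ≤ (1 − β^{−1}) Z²`.  Instance: `κ = 2/5` is `QuantileBitDoorDeepR` (⟨24094⟩, below).  No summit / crux is proved; the YM mass gap is
NOT proved. [cite: MadrasSokal1988, §2] [cite: ReedSimonIV1978, Thm. XIII.1] [cite: MontvayMunster1994, (3.145)] [cite: Luscher1983, §2] -/
theorem quantileBitDoorR_of_cap (κ : ℝ)
    (hX1 : ∃ γc : ℝ, 0 < γc ∧ γc ≤ κ ∧ ∃ q : ℝ, q < 1 ∧ ∃ a : ℝ, 0 < a ∧ ∃ β₀ : ℝ, ∃ L₀ : ℕ, ∀ β : ℝ, β₀ ≤ β →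
      ∀ (L : ℕ) [NeZero L], L₀ ≤ L → (L : ℝ) ≤ β ^ a →
        ringInsTrace L β (L - 1) (Set.indicator {U : GaugeConfig 3 L SU2 | polDist U ≤ β ^ (-γc)} fun _ => (1 : ℝ)) 0 ≤ q * physTrace L β L)
    (hXE : ∀ γc : ℝ, 0 < γc → γc ≤ κ → ∀ ε : ℝ, 0 < ε → ∃ a : ℝ, 0 < a ∧ ∃ β₀ : ℝ, ∃ L₀ : ℕ, ∀ β : ℝ, β₀ ≤ β →
      ∀ (L : ℕ) [NeZero L], L₀ ≤ L → (L : ℝ) ≤ β ^ a →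
        ringInsTrace L β (L - 1) (Set.indicator {U : GaugeConfig 3 L SU2 | 2 - β ^ (-γc) ≤ polDist U} fun _ => (1 : ℝ)) 0 ≤ ε * physTrace L β L)
    (hX2 : ∀ γc : ℝ, γc ≤ κ → ∃ a₀ : ℝ, 0 < a₀ ∧ a₀ ≤ 1 ∧ ∀ a : ℝ, 0 < a → a ≤ a₀ → ∃ γ : ℝ, γ < 1 / 2 - 3 * a ∧ ∃ β₀ : ℝ, ∃ L₀ : ℕ,
      ∀ β : ℝ, β₀ ≤ β → ∀ (L : ℕ) [NeZero L], L₀ ≤ L → (L : ℝ) ≤ β ^ a → ∀ c : ℝ, β ^ (-γc) ≤ c → c ≤ 2 - β ^ (-γc) →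
        ringInsTrace L β (L - 1) (Set.indicator {U : GaugeConfig 3 L SU2 | |polDist U - c| ≤ β ^ (-γ)} fun _ => (1 : ℝ)) 0 ≤ β ^ (-a) * physTrace L β L) :
    ∃ a : ℝ, 0 < a ∧ ∃ k β₀ : ℝ, ∃ L₀ : ℕ, ∀ β : ℝ, β₀ ≤ β → ∀ (L : ℕ) [NeZero L], L₀ ≤ L → (L : ℝ) ≤ β ^ a →
      physTrace L β (2 * L) ≤ (1 - β ^ (-k)) * physTrace L β L ^ 2 := by
  obtain ⟨γc, hγc0, hγcκ, q, hq1, a₁, ha₁, β₁, L₁, h1⟩ := hX1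
  obtain ⟨a₀, ha₀, ha₀1, h2'⟩ := hX2 γc hγcκ
  obtain ⟨γ, hγ, β₂, L₂, h2⟩ := h2' a₀ ha₀ le_rfl
  obtain ⟨βP, hβP9, hP⟩ := bit_one_step_ge ha₀ ha₀1 hγ
  -- constants
  set q' : ℝ := max q 0 with hq'
  set θ : ℝ := (1 + q') / 2 with hθ
  set g : ℝ := (1 - q') / 2 with hg
  have hq'0 : 0 ≤ q' := le_max_right _ _
  have hq'1 : q' < 1 := max_lt hq1 one_pos
  have hg0 : 0 < g := by rw [hg]; linarith
  have hθg : θ = 1 - g := by rw [hθ, hg]; ring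
  have hθhalf : 1 / 2 ≤ θ := by rw [hθ]; linarith
  have hθ1 : θ ≤ 1 := by rw [hθ]; linarith
  -- the equator band with `ε = g/2 = (1 − q⁺)/4`
  obtain ⟨a₂, ha₂, β₃, L₃, h3⟩ := hXE γc hγc0 hγcκ (g / 2) (by positivity)
  set ex : ℝ := min (a₀ / 2) (1 / 3) with hex
  have hex0 : 0 < ex := lt_min (by linarith) (by norm_num)
  set βg : ℝ := (8 / g) ^ (1 / ex) with hβg
  set a : ℝ := min (min a₁ (a₀ / 2)) a₂ with hadef
  have ha : 0 < a := lt_min (lt_min ha₁ (by linarith)) ha₂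
  refine ⟨a, ha, 1, max (max (max β₁ β₂) (max βP 2)) (max βg β₃), max (max L₁ L₂) (max 3 L₃), fun β hβ L _ hL hLβ => ?_⟩
  -- thresholds
  have hββ₁ : β₁ ≤ β := (((le_max_left _ _).trans (le_max_left _ _)).trans (le_max_left _ _)).trans hβ
  have hββ₂ : β₂ ≤ β := (((le_max_right _ _).trans (le_max_left _ _)).trans (le_max_left _ _)).trans hβ
  have hββP : βP ≤ β := (((le_max_left _ _).trans (le_max_right _ _)).trans (le_max_left _ _)).trans hβ
  have hββg : βg ≤ β := ((le_max_left _ _).trans (le_max_right _ _)).trans hβ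
  have hββ₃ : β₃ ≤ β := ((le_max_right _ _).trans (le_max_right _ _)).trans hβ
  have hβ9 : 9 ≤ β := hβP9.trans hββP
  have hβ1 : 1 ≤ β := by linarith
  have hβ0 : 0 < β := by linarith
  -- `β^{-x} ≤ β^{-e}` for `e ≤ x`
  have rpow_neg_le_rpow_neg : ∀ {e x : ℝ}, e ≤ x → β ^ (-x) ≤ β ^ (-e) := fun h =>
    Real.rpow_le_rpow_of_exponent_le hβ1 (neg_le_neg h)
  have hLL₁ : L₁ ≤ L := ((le_max_left _ _).trans (le_max_left _ _)).trans hL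
  have hLL₂ : L₂ ≤ L := ((le_max_right _ _).trans (le_max_left _ _)).trans hL
  have hL3 : 3 ≤ L := ((le_max_left _ _).trans (le_max_right _ _)).trans hL
  have hLL₃ : L₃ ≤ L := ((le_max_right _ _).trans (le_max_right _ _)).trans hL
  obtain ⟨n, rfl⟩ : ∃ n, L = n + 1 := ⟨L - 1, by omega⟩
  have hn2 : 2 ≤ n := by omega
  -- the windows of the three hypotheses
  have hLa₁ : ((n + 1 : ℕ) : ℝ) ≤ β ^ a₁ :=
    hLβ.trans (Real.rpow_le_rpow_of_exponent_le hβ1 ((min_le_left _ _).trans (min_le_left _ _)))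
  have hLah : ((n + 1 : ℕ) : ℝ) ≤ β ^ (a₀ / 2) :=
    hLβ.trans (Real.rpow_le_rpow_of_exponent_le hβ1 ((min_le_left _ _).trans (min_le_right _ _)))
  have hLa₀ : ((n + 1 : ℕ) : ℝ) ≤ β ^ a₀ := hLah.trans (Real.rpow_le_rpow_of_exponent_le hβ1 (by linarith))
  have hLa₂ : ((n + 1 : ℕ) : ℝ) ≤ β ^ a₂ := hLβ.trans (Real.rpow_le_rpow_of_exponent_le hβ1 (min_le_right _ _))
  -- the small quantities
  have hexp_e : β ^ (-ex) ≤ g / 8 := by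
    -- past the threshold `β ≥ (8/g)^{1/ex}`
    have h8g : 0 < 8 / g := by positivity
    have hthr : 0 < (8 / g) ^ (1 / ex) := Real.rpow_pos_of_pos h8g _
    have hββg' : (8 / g) ^ (1 / ex) ≤ β := by rw [hβg] at hββg; exact hββg
    have h1 : (8 / g) ≤ β ^ ex := by
      have h := Real.rpow_le_rpow hthr.le hββg' hex0.le
      rwa [← Real.rpow_mul h8g.le, show 1 / ex * ex = 1 by field_simp, Real.rpow_one] at h
    rw [Real.rpow_neg hβ0.le]
    calc (β ^ ex)⁻¹ ≤ (8 / g)⁻¹ := inv_anti₀ h8g h1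
      _ = g / 8 := by rw [inv_div]
  have hεa : β ^ (-a₀) ≤ g / 8 := (rpow_neg_le_rpow_neg (by rw [hex]; exact (min_le_left _ _).trans (by linarith))).trans hexp_e
  have hεah : β ^ (-(a₀ / 2)) ≤ g / 8 := (rpow_neg_le_rpow_neg (min_le_left _ _)).trans hexp_e
  have hε3 : β ^ (-(1 / 3 : ℝ)) ≤ g / 8 := (rpow_neg_le_rpow_neg (min_le_right _ _)).trans hexp_e
  have hε1 : β⁻¹ ≤ β ^ (-(1 / 3 : ℝ)) := by
    rw [← Real.rpow_neg_one]; exact rpow_neg_le_rpow_neg (by norm_num)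
  have hεa0 : 0 ≤ β ^ (-a₀) := Real.rpow_nonneg hβ0.le _
  have hεah0 : 0 ≤ β ^ (-(a₀ / 2)) := Real.rpow_nonneg hβ0.le _
  have hε30 : 0 ≤ β ^ (-(1 / 3 : ℝ)) := Real.rpow_nonneg hβ0.le _
  have hg1 : g ≤ 1 / 2 := by rw [hg]; linarith
  -- `Z` and its positivity
  set Z : ℝ := physTrace (n + 1) β (n + 1) with hZ
  have hZdef : physTraceSucc (n + 1) β n = Z := rfl
  have hZS := traceFormula (n + 1) β (n + 1) hβ1 (by omega)
  have hlamZ' : levelValue su2Rep (n + 1) β 0 ^ (n + 1) ≤ Z := le_hasSum hZS 0 fun k _ => pow_nonneg (levelValue_su2Rep_pos hβ0 k).le _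
  have hZpos : 0 < Z := lt_of_lt_of_le (pow_pos (levelValue_zero_su2Rep_pos (n + 1) β) _) hlamZ'
  -- the slice weights `W(S)` and `F(c) = W{polDist ≤ c}`
  set F : ℝ → ℝ := fun c => ringInsTrace (n + 1) β n ({U : GaugeConfig 3 (n + 1) SU2 | polDist U ≤ c}.indicator fun _ => (1 : ℝ)) 0 with hF
  -- X1 at the core scale, X2R at every admissible centre, EQ at the equator band
  have hX1' : F (β ^ (-γc)) ≤ q' * Z := by
    have h := h1 β hββ₁ (n + 1) hLL₁ hLa₁
    rw [Nat.add_sub_cancel] at h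
    exact h.trans (mul_le_mul_of_nonneg_right (le_max_left _ _) hZpos.le)
  have hX2' : ∀ c : ℝ, β ^ (-γc) ≤ c → c ≤ 2 - β ^ (-γc) →
      ringInsTrace (n + 1) β n ({U : GaugeConfig 3 (n + 1) SU2 | |polDist U - c| ≤ β ^ (-γ)}.indicator fun _ => (1 : ℝ)) 0 ≤ β ^ (-a₀) * Z := by
    intro c hc hc2
    have h := h2 β hββ₂ (n + 1) hLL₂ hLa₀ c hc hc2
    rw [Nat.add_sub_cancel] at h
    exact h
  have hXE' : ringInsTrace (n + 1) β n ({U : GaugeConfig 3 (n + 1) SU2 | 2 - β ^ (-γc) ≤ polDist U}.indicator fun _ => (1 : ℝ)) 0 ≤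
      g / 2 * Z := by
    have h := h3 β hββ₃ (n + 1) hLL₃ hLa₂
    rw [Nat.add_sub_cancel] at h
    exact h
  -- the cut grid: `x₀ = β^{-γc}`, step `h = β^{-γ}`, `K = ⌊(2 − 2x₀)/h⌋` (all centres in `[x₀, 2 − x₀]`)
  set x₀ : ℝ := β ^ (-γc) with hx₀
  set hh : ℝ := β ^ (-γ) with hhh
  have hh0 : 0 < hh := Real.rpow_pos_of_pos hβ0 _
  have hx₀0 : 0 < x₀ := Real.rpow_pos_of_pos hβ0 _
  have hx₀1 : x₀ ≤ 1 := Real.rpow_le_one_of_one_le_of_nonpos hβ1 (by linarith)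
  set K : ℕ := ⌊(2 - 2 * x₀) / hh⌋₊ with hK
  have hKle : x₀ + K * hh ≤ 2 - x₀ := by
    have hK' : (K : ℝ) ≤ (2 - 2 * x₀) / hh := Nat.floor_le (div_nonneg (by linarith) hh0.le)
    have := mul_le_mul_of_nonneg_right hK' hh0.le
    rw [div_mul_cancel₀ _ hh0.ne'] at this
    linarith
  have hKgt : 2 - x₀ - hh < x₀ + K * hh := by
    have hK' : (2 - 2 * x₀) / hh < (K : ℝ) + 1 := Nat.lt_floor_add_one _
    have := mul_lt_mul_of_pos_right hK' hh0
    rw [div_mul_cancel₀ _ hh0.ne', add_mul, one_mul] at this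
    linarith
  have hF0 : F x₀ < θ * Z := by
    have hθq : q' < θ := by rw [hθ]; linarith
    exact lt_of_le_of_lt hX1' (mul_lt_mul_of_pos_right hθq hZpos)
  -- the level `θ Z` is reached at the last grid point: its complement lies in one Lévy window at the centre `2 − x₀` plus the equator band
  have hFK : θ * Z ≤ F (x₀ + K * hh) := by
    have hAK : MeasurableSet {U : GaugeConfig 3 (n + 1) SU2 | polDist U ≤ x₀ + K * hh} := measurableSet_polDist_le _
    have hNe : MeasurableSet {U : GaugeConfig 3 (n + 1) SU2 | |polDist U - (2 - x₀)| ≤ hh} := measurableSet_polDist_near _ _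
    have hBd : MeasurableSet {U : GaugeConfig 3 (n + 1) SU2 | 2 - x₀ ≤ polDist U} :=
      measurableSet_le measurable_const measurable_polDist
    have hsub : {U : GaugeConfig 3 (n + 1) SU2 | polDist U ≤ x₀ + K * hh}ᶜ ⊆
        {U : GaugeConfig 3 (n + 1) SU2 | |polDist U - (2 - x₀)| ≤ hh} ∪ {U : GaugeConfig 3 (n + 1) SU2 | 2 - x₀ ≤ polDist U} := by
      intro U hU
      have hU' : ¬ polDist U ≤ x₀ + K * hh := hU
      by_cases hb : 2 - x₀ ≤ polDist U
      · exact Or.inr hb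
      · left
        show |polDist U - (2 - x₀)| ≤ hh
        rw [abs_le]; constructor <;> linarith [not_le.1 hU', not_le.1 hb]
    have hm := ringInsTrace_indicator_zero_mono hβ0.le n hAK.compl (hNe.union hBd) hsub
    have hu := ringInsTrace_indicator_zero_union_le hβ0.le n hNe hBd
    have hx := hX2' (2 - x₀) (by linarith) le_rfl
    have hcomplK : F (x₀ + K * hh) +
        ringInsTrace (n + 1) β n ({U : GaugeConfig 3 (n + 1) SU2 | polDist U ≤ x₀ + K * hh}ᶜ.indicator fun _ => (1 : ℝ)) 0 = Z := by
      rw [← hZdef]; exact ringInsTrace_indicator_zero_add_compl hβ0.le n hAK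
    have hεaZ : β ^ (-a₀) * Z ≤ g / 8 * Z := mul_le_mul_of_nonneg_right hεa hZpos.le
    have hgZ : 0 ≤ g * Z := mul_nonneg hg0.le hZpos.le
    rw [hθg]
    linarith [hm.trans hu, hx, hXE', hcomplK, hεaZ, hgZ]
  obtain ⟨i, hi1, hiK, hlt, hge⟩ := exists_grid_crossing F x₀ hh (θ * Z) hF0 hFK
  set c : ℝ := x₀ + i * hh with hcdef
  set c' : ℝ := x₀ + ((i - 1 : ℕ) : ℝ) * hh with hc'def
  have hcc' : c = c' + hh := by
    rw [hcdef, hc'def]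
    have : ((i : ℕ) : ℝ) = ((i - 1 : ℕ) : ℝ) + 1 := by
      rw [Nat.cast_sub hi1]; push_cast; ring
    rw [this]; ring
  have hc_ge : β ^ (-γc) ≤ c := by
    rw [hcdef]
    have : 0 ≤ (i : ℝ) * hh := by positivity
    linarith
  have hc_le : c ≤ 2 - β ^ (-γc) := by
    have : (i : ℝ) * hh ≤ (K : ℝ) * hh := mul_le_mul_of_nonneg_right (by exact_mod_cast hiK) hh0.le
    rw [hcdef]
    linarith [hKle]
  -- `θ Z ≤ F c < (θ + β^{-a₀}) Z`
  have hAc : MeasurableSet {U : GaugeConfig 3 (n + 1) SU2 | polDist U ≤ c} := measurableSet_polDist_le c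
  have hAc' : MeasurableSet {U : GaugeConfig 3 (n + 1) SU2 | polDist U ≤ c'} := measurableSet_polDist_le c'
  have hNc : MeasurableSet {U : GaugeConfig 3 (n + 1) SU2 | |polDist U - c| ≤ hh} := measurableSet_polDist_near c hh
  have hFc_lt : F c < (θ + β ^ (-a₀)) * Z := by
    have hsub : {U : GaugeConfig 3 (n + 1) SU2 | polDist U ≤ c} ⊆
        {U : GaugeConfig 3 (n + 1) SU2 | polDist U ≤ c'} ∪ {U : GaugeConfig 3 (n + 1) SU2 | |polDist U - c| ≤ hh} := by
      intro U hU
      have hU' : polDist U ≤ c := hU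
      by_cases hU2 : polDist U ≤ c'
      · exact Or.inl hU2
      · right
        show |polDist U - c| ≤ hh
        rw [abs_le]; constructor <;> linarith [not_le.1 hU2]
    have hm := ringInsTrace_indicator_zero_mono hβ0.le n hAc (hAc'.union hNc) hsub
    have hu := ringInsTrace_indicator_zero_union_le hβ0.le n hAc' hNc
    have hx := hX2' c hc_ge hc_le
    have hlt' : F c' < θ * Z := hlt
    calc F c ≤ F c' + ringInsTrace (n + 1) β n ({U : GaugeConfig 3 (n + 1) SU2 | |polDist U - c| ≤ hh}.indicator fun _ => (1 : ℝ)) 0 :=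
          hm.trans hu
      _ < θ * Z + β ^ (-a₀) * Z := add_lt_add_of_lt_of_le hlt' hx
      _ = (θ + β ^ (-a₀)) * Z := by ring
  have hFc_ge : θ * Z ≤ F c := hge
  -- the complementary weight
  have hcompl : F c + ringInsTrace (n + 1) β n ({U : GaugeConfig 3 (n + 1) SU2 | polDist U ≤ c}ᶜ.indicator fun _ => (1 : ℝ)) 0 = Z := by
    rw [← hZdef]; exact ringInsTrace_indicator_zero_add_compl hβ0.le n hAc
  have hmaxW : max (ringInsTrace (n + 1) β n ({U : GaugeConfig 3 (n + 1) SU2 | polDist U ≤ c}.indicator fun _ => (1 : ℝ)) 0)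
      (ringInsTrace (n + 1) β n ({U : GaugeConfig 3 (n + 1) SU2 | polDist U ≤ c}ᶜ.indicator fun _ => (1 : ℝ)) 0) ≤ (θ + β ^ (-a₀)) * Z := by
    refine max_le hFc_lt.le ?_
    have h1 : ringInsTrace (n + 1) β n ({U : GaugeConfig 3 (n + 1) SU2 | polDist U ≤ c}ᶜ.indicator fun _ => (1 : ℝ)) 0 = Z - F c := by
      linarith [hcompl]
    rw [h1]
    have h2 : (1 - θ) * Z ≤ θ * Z := mul_le_mul_of_nonneg_right (by linarith) hZpos.le
    have h3 : 0 ≤ β ^ (-a₀) * Z := mul_nonneg hεa0 hZpos.le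
    nlinarith [hFc_ge, h2, h3]
  -- the bit, persistence
  set O : GaugeConfig 3 (n + 1) SU2 → ℝ := fun U => 1 - 2 * {U : GaugeConfig 3 (n + 1) SU2 | polDist U ≤ c}.indicator (fun _ => (1 : ℝ)) U
    with hO
  have hOP : IsPhys O := isPhys_bit c
  have hI1 : (1 - 3 * β ^ (-a₀)) * Z ≤ ringInsTrace (n + 1) β n O 1 := hP β hββP n (by omega) hLa₀ c (hX2' c hc_ge hc_le)
  -- the levels: Jensen and split at `m = ⌊(n+1)/2⌋`, scale `σ = β^{1/(n+1)}`
  set m : ℕ := (n + 1) / 2 with hmdef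
  have hm1 : 1 ≤ m := by omega
  have hm2 : m + 1 ≤ n := by omega
  have h2m : 2 * m ≤ n + 1 := by omega
  have h3m : n + 1 ≤ 3 * m := by omega
  have hNpos : (0 : ℝ) < ((n + 1 : ℕ) : ℝ) := by positivity
  set σ : ℝ := β ^ ((1 : ℝ) / ((n + 1 : ℕ) : ℝ)) with hσdef
  have hσ0 : 0 < σ := Real.rpow_pos_of_pos hβ0 _
  have hσ1 : 1 ≤ σ := Real.one_le_rpow hβ1 (by positivity)
  obtain ⟨hJ, hS, hlamZ, hdouble, hlam0⟩ := ring_levels hβ1 hm1 hm2 hAc (isPhys_indicator_polDist_le c) (isPhys_indicator_polDist_le_compl c)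
    hOP (bit_eq_indicator_sub c) hσ0
  set p : ℝ := levelValue su2Rep (n + 1) β 0 ^ (n + 1) with hpdef
  have hp0 : 0 ≤ p := pow_nonneg hlam0.le _
  set Im : ℝ := ringInsTrace (n + 1) β n O m with hImdef
  set I1 : ℝ := ringInsTrace (n + 1) β n O 1 with hI1def
  -- (a) `I_m ≥ (1 − 1.5 β^{-a₀/2}) Z`
  set δ : ℝ := 3 * β ^ (-a₀) with hδ
  have hδ0 : 0 ≤ δ := by positivity
  have hδ1 : δ ≤ 1 := by rw [hδ]; linarith
  have hI1_0 : 0 ≤ I1 := le_trans (mul_nonneg (by linarith) hZpos.le) hI1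
  have hIm_ge : (1 - (m : ℝ) * δ) * Z ≤ Im := by
    -- `((1-δ) Z)^m ≤ I1^m ≤ Im Z^{m-1}`
    have h1 : ((1 - δ) * Z) ^ m ≤ Im * Z ^ (m - 1) := (pow_le_pow_left₀ (mul_nonneg (by linarith) hZpos.le) hI1 m).trans hJ
    have hZm : Z ^ m = Z * Z ^ (m - 1) := by rw [← pow_succ']; congr 1; omega
    rw [mul_pow, hZm, ← mul_assoc] at h1
    have h2 : (1 - δ) ^ m * Z ≤ Im := le_of_mul_le_mul_right h1 (pow_pos hZpos _)
    have hB : 1 - (m : ℝ) * δ ≤ (1 - δ) ^ m := by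
      have h := one_add_mul_le_pow (show (-2 : ℝ) ≤ -δ by linarith) m
      have e1 : 1 + (m : ℝ) * -δ = 1 - (m : ℝ) * δ := by ring
      have e2 : (1 + -δ) = 1 - δ := by ring
      rw [e1, e2] at h; exact h
    exact (mul_le_mul_of_nonneg_right hB hZpos.le).trans h2
  have hmδ : (m : ℝ) * δ ≤ 3 / 2 * β ^ (-(a₀ / 2)) := by
    have hmle : (m : ℝ) ≤ ((n + 1 : ℕ) : ℝ) / 2 := by
      rw [le_div_iff₀ (by norm_num : (0 : ℝ) < 2)]; exact_mod_cast (by omega : m * 2 ≤ n + 1)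
    have hmle2 : (m : ℝ) ≤ β ^ (a₀ / 2) / 2 := hmle.trans (by linarith)
    have hprod : β ^ (a₀ / 2) * β ^ (-a₀) = β ^ (-(a₀ / 2)) := by
      rw [← Real.rpow_add hβ0]; congr 1; ring
    calc (m : ℝ) * δ ≤ β ^ (a₀ / 2) / 2 * δ := mul_le_mul_of_nonneg_right hmle2 hδ0
      _ = 3 / 2 * (β ^ (a₀ / 2) * β ^ (-a₀)) := by rw [hδ]; ring
      _ = 3 / 2 * β ^ (-(a₀ / 2)) := by rw [hprod]
  have hIm_ge' : (1 - 3 / 2 * β ^ (-(a₀ / 2))) * Z ≤ Im :=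
    (mul_le_mul_of_nonneg_right (by linarith) hZpos.le).trans hIm_ge
  -- (b) the key claim: `β⁻¹ Z ≤ Z − λ₀^{n+1}`
  have hσA : σ ^ (n + 1 - m) = β ^ (((n + 1 - m : ℕ) : ℝ) / ((n + 1 : ℕ) : ℝ)) := by
    rw [hσdef, ← Real.rpow_natCast, ← Real.rpow_mul hβ0.le]; congr 1; field_simp
  have hσB : σ ^ m = β ^ ((m : ℝ) / ((n + 1 : ℕ) : ℝ)) := by
    rw [hσdef, ← Real.rpow_natCast, ← Real.rpow_mul hβ0.le]; congr 1; field_simp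
  have hmN : (1 / 3 : ℝ) ≤ (m : ℝ) / ((n + 1 : ℕ) : ℝ) := by
    rw [div_le_div_iff₀ (by norm_num) hNpos]; norm_cast; omega
  have hAm : (m : ℝ) / ((n + 1 : ℕ) : ℝ) ≤ ((n + 1 - m : ℕ) : ℝ) / ((n + 1 : ℕ) : ℝ) := by
    refine div_le_div_of_nonneg_right ?_ hNpos.le; norm_cast; omega
  have hinvB : (σ ^ m)⁻¹ ≤ β ^ (-(1 / 3 : ℝ)) := by
    rw [hσB, ← Real.rpow_neg hβ0.le]; exact rpow_neg_le_rpow_neg hmN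
  have hinvA : (σ ^ (n + 1 - m))⁻¹ ≤ β ^ (-(1 / 3 : ℝ)) := by
    rw [hσA, ← Real.rpow_neg hβ0.le]; exact rpow_neg_le_rpow_neg (hmN.trans hAm)
  have hσAB : σ ^ m ≤ σ ^ (n + 1 - m) := pow_le_pow_right₀ hσ1 (by omega)
  have hσA1 : β⁻¹ * σ ^ (n + 1 - m) ≤ β ^ (-(1 / 3 : ℝ)) := by
    rw [hσA, ← Real.rpow_neg_one, ← Real.rpow_add hβ0]
    refine (Real.rpow_le_rpow_of_exponent_le hβ1 ?_).trans (le_refl _) |>.trans (rpow_neg_le_rpow_neg hmN)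
    -- `-1 + (n+1-m)/(n+1) = -(m/(n+1))`
    have e : (-1 : ℝ) + ((n + 1 - m : ℕ) : ℝ) / ((n + 1 : ℕ) : ℝ) = -((m : ℝ) / ((n + 1 : ℕ) : ℝ)) := by
      rw [Nat.cast_sub (by omega : m ≤ n + 1)]
      field_simp
      ring
    rw [e]
  have hkey : β⁻¹ * Z ≤ Z - p := by
    by_contra hcon
    have hE : Z - p < β⁻¹ * Z := not_le.1 hcon
    have hE0 : 0 ≤ Z - p := by linarith [hlamZ]
    -- the split bound under `Z − p < β⁻¹ Z`
    have hb1 : (Z - p) * (1 + σ ^ (n + 1 - m) + σ ^ m) ≤ 3 * β ^ (-(1 / 3 : ℝ)) * Z := by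
      have h1 : (Z - p) * σ ^ (n + 1 - m) ≤ β ^ (-(1 / 3 : ℝ)) * Z := by
        calc (Z - p) * σ ^ (n + 1 - m) ≤ β⁻¹ * Z * σ ^ (n + 1 - m) := mul_le_mul_of_nonneg_right hE.le (by positivity)
          _ = β⁻¹ * σ ^ (n + 1 - m) * Z := by ring
          _ ≤ β ^ (-(1 / 3 : ℝ)) * Z := mul_le_mul_of_nonneg_right hσA1 hZpos.le
      have h2 : (Z - p) * σ ^ m ≤ β ^ (-(1 / 3 : ℝ)) * Z := (mul_le_mul_of_nonneg_left hσAB hE0).trans h1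
      have h3 : (Z - p) * 1 ≤ β ^ (-(1 / 3 : ℝ)) * Z := by
        rw [mul_one]; exact hE.le.trans (mul_le_mul_of_nonneg_right hε1 hZpos.le)
      have e : (Z - p) * (1 + σ ^ (n + 1 - m) + σ ^ m) = (Z - p) * 1 + (Z - p) * σ ^ (n + 1 - m) + (Z - p) * σ ^ m := by ring
      rw [e]; linarith [h1, h2, h3]
    have hb2 : p * ((σ ^ (n + 1 - m))⁻¹ + (σ ^ m)⁻¹) ≤ 2 * β ^ (-(1 / 3 : ℝ)) * Z := by
      have h1 : p * (σ ^ (n + 1 - m))⁻¹ ≤ Z * β ^ (-(1 / 3 : ℝ)) := mul_le_mul hlamZ hinvA (by positivity) hZpos.le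
      have h2 : p * (σ ^ m)⁻¹ ≤ Z * β ^ (-(1 / 3 : ℝ)) := mul_le_mul hlamZ hinvB (by positivity) hZpos.le
      rw [mul_add]; linarith [h1, h2]
    have hup : Im ≤ (θ + β ^ (-a₀)) * Z + 3 * β ^ (-(1 / 3 : ℝ)) * Z + 2 * β ^ (-(1 / 3 : ℝ)) * Z := by
      linarith [hS, hmaxW, hb1, hb2]
    -- compare with the lower bound and divide by `Z`
    have hcmp : (1 - 3 / 2 * β ^ (-(a₀ / 2))) * Z ≤ (θ + β ^ (-a₀) + 5 * β ^ (-(1 / 3 : ℝ))) * Z := by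
      have e : (θ + β ^ (-a₀) + 5 * β ^ (-(1 / 3 : ℝ))) * Z =
          (θ + β ^ (-a₀)) * Z + 3 * β ^ (-(1 / 3 : ℝ)) * Z + 2 * β ^ (-(1 / 3 : ℝ)) * Z := by ring
      rw [e]; exact hIm_ge'.trans hup
    have hcmp' : 1 - 3 / 2 * β ^ (-(a₀ / 2)) ≤ θ + β ^ (-a₀) + 5 * β ^ (-(1 / 3 : ℝ)) := le_of_mul_le_mul_right hcmp hZpos
    rw [hθg] at hcmp'
    linarith [hcmp', hεa, hεah, hε3, hg0]
  -- (c) conclusion: `Z(2L) ≤ λ₀^L Z ≤ (1 − β⁻¹) Z²`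
  have hpZ : p ≤ (1 - β⁻¹) * Z := by linarith [hkey]
  rw [Real.rpow_neg_one]
  calc physTrace (n + 1) β (2 * (n + 1)) ≤ p * Z := hdouble
    _ ≤ (1 - β⁻¹) * Z * Z := mul_le_mul_of_nonneg_right hpZ hZpos.le
    _ = (1 - β⁻¹) * Z ^ 2 := by ring


/-- ★ **`QuantileBitDoorDeepR` holds** (item stmt-QuantumFields-24094 of route `QuantileBitPurity`, rev 4): `HolonomyQuantileSubQuartic → EquatorBandVanishing →
HolonomyLevyWindowDeepR → ∃ a > 0, ∃ k β₀ L₀, ∀ β ≥ β₀, ∀ L₀ ≤ L ≤ β^a, Z_phys(2L×L³) ≤ (1 − β^{−k}) Z_phys(L×L³)²` — the instance `κ = 2/5` of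
`quantileBitDoorR_of_cap` (the restricted deep-cap path of the route: X1 with cap `2/5` below the quartic scale, the rate-free equator band, X2R at centres
`β^{−γc} ≤ c ≤ 2 − β^{−γc}` for every cap `≤ 2/5`).  No summit / crux is proved; the YM mass gap is NOT proved.
[cite: MadrasSokal1988, §2] [cite: ReedSimonIV1978, Thm. XIII.1] -/
theorem quantileBitDoorDeepR_proof : Summit.QuantumFields.YangMills.Theses.QuantileBitPurity.QuantileBitDoorDeepR := by
  intro hX1 hXE hX2
  exact quantileBitDoorR_of_cap (2 / 5) hX1 hXE hX2

end Summit.QuantumFields.YangMills.Theorems.QuantileBitPurity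

end
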